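import Summits.BirchSwinnertonDyer.BirchSwinnertonDyer.Theorems.KolyvaginDepthDoorDepthTableRowKitTwistKN
import Summits.BirchSwinnertonDyer.BirchSwinnertonDyer.Theorems.KolyvaginDepthDoorDepthTableRowsOfPrint5
import Summits.BirchSwinnertonDyer.BirchSwinnertonDyer.Theorems.KolyvaginDepthDoorDepthTableRowsOfPrint6
import HarnessLib

/-!
# Route `KolyvaginDepthDoor` — rank-2 TWIST-SELMER depth-table rows `997c1`, `664a1`, `916c1`
# ON (γ) ONLY (Kodaira–Néron certified in the kernel; crux `KolyvaginDepthSupply`,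
# stmt-BirchSwinnertonDyer-21765) — part 4 of 4

Helper file (`--supports stmt-BirchSwinnertonDyer-21765 --as helper`); it closes nothing and BSD is
not proved by it.

g6/g7's twist-Selmer rows display the FIVE named McCallum / Gross leaves; `…RowsTwistSelmerPrint*` (this
seat) read them modulo (γ) + F1. This file drops F1: every curve here is on the Kodaira–Néron cell at its
`p` (`p ∤ ord_v Δ_min` at multiplicative `v`, certified from `Δ(E₀)` by the `decide`-able table of
`depthRow_twistSelmer_printKN_of_datum_of_intModel_certificate`; no additive clause at `p ≥ 5`). Inputs of
each row `C<label>.twistSelmer_<p>_neg<D>_<ℓ>_printKN`: (γ) = `GrossLMS1991.prop37_2_frobeniusCongruence` +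
the bit at ANY datum of conductor `ℓ`; conclusion `#Sel^(p)(E^{(D)}/ℚ) ≤ p` and the descent count `≤ p`.
(`944e1`, off the cell at `5`, keeps its (γ)+F1 row `…_print`.) CONDITIONAL on (γ) and the bit; per-curve;
BSD is not proved by it.
-/

set_option linter.dupNamespace false

noncomputable section

open scoped Classical NumberField

namespace Summit.BirchSwinnertonDyer.BirchSwinnertonDyer.Theorems.KolyvaginDepthDoor

open Literature.NumberTheory.EllipticCurves Literature.NumberTheory.EllipticCurves.ModularForms
  Literature.NumberTheory.EllipticCurves.McCallum1991 WeierstrassCurve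
open Summit.BirchSwinnertonDyer.BirchSwinnertonDyer.Rank2Observatory
open Summit.BirchSwinnertonDyer.BirchSwinnertonDyer.Rank1Residual

namespace C997c1

/-- **DEPTH-TABLE ROW `997c1`, `(p, d_K, ℓ) = (5, -67, 229)` — THE TWIST'S `5`-SELMER GROUP, without
Kolyvagin's structure theorem, without a point on the twist, and WITHOUT A SYSTEM.** Hypotheses
those of `C997c1.depthRow_5_neg67_229_print` ((γ) = Gross 1991 Prop. 3.7 (2) in place of the five
McCallum/Gross leaves — three are theorems after g8, Lemma 4.3 is proved on the Kodaira–Néron cell,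
certified here from `Δ(E₀) = 997` —, any imaginary quadratic `K` with `d_K = -67`, any frame, ANY
single datum `d` of conductor `229` — NO system — and its bit `d.kolyvaginClass _ 1 ≠ 0`);
conclusion: `#Sel^(5)(E^{(-67)}/ℚ) ≤ 5` (i.e. `dim_𝔽5 Sel_5(E^{(-67)}/ℚ) ≤ 1`) and the descent count
`5^{rank E^{(-67)}(ℚ)} · #E^{(-67)}(ℚ)[5] · #Ш(E^{(-67)}/ℚ)[5] ≤ 5` — Kolyvagin's second eigen-bound
`#Sel(E/K)_5^- ≤ 5` read over `ℚ` (kit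
`depthRow_twistSelmer_printKN_of_datum_of_intModel_certificate`; the compatible system through `d`
is the theorem `exists_kolyvaginHeegnerSystem_extending`); the hF-free, twist-point-free counterpart
of the hF-row's `corank Sel_{5^∞}(E^{(-67)}/ℚ) = 1`. CONDITIONAL on (γ) and the bit; per-curve; BSD
is not proved by it. [cite: Kolyvagin1991MathAnn, Thm. 2.3] [cite: McCallumLMS1991, §§2–5] [cite:
GrossLMS1991, §5 (5.1)] [cite: JetchevLauterStein2009, §3.6 (arXiv:0707.0032)] -/
theorem twistSelmer_5_neg67_229_printKN
    (h372 : GrossLMS1991.prop37_2_frobeniusCongruence)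
    (K : Type) [Field K] [NumberField K] (hK : IsImaginaryQuadratic K)
    (hD : NumberField.discr K = -67) :
    haveI := isElliptic_c997c1;
    haveI := isGloballyMinimal_c997c1;
    haveI : NeZero (((⟨0, -1, 1, -24, 54⟩ : WeierstrassCurve ℤ).map (Int.castRingHom ℚ)).conductorNorm ℤ) :=
      neZero_conductorNorm_of_isElliptic _;
    ∀ (Dt : ModularParametrizationData ((⟨0, -1, 1, -24, 54⟩ : WeierstrassCurve ℤ).map (Int.castRingHom ℚ))
        (((⟨0, -1, 1, -24, 54⟩ : WeierstrassCurve ℤ).map (Int.castRingHom ℚ)).conductorNorm ℤ)) (β : ℤ)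
      (ι : K →+* ℂ) (d : KolyvaginHeegnerData Dt β ι 229),
    d.kolyvaginClass (p := 5) (by norm_num) 1 ≠ 0 →
    Nat.card ↥(selmerGroup (((⟨0, -1, 1, -24, 54⟩ : WeierstrassCurve ℤ).map (Int.castRingHom ℚ)).quadraticTwist
        ((-67 : ℤ) : ℚ)) ((5 : ℕ) : ℤ)) ≤ 5 ∧
      5 ^ (((⟨0, -1, 1, -24, 54⟩ : WeierstrassCurve ℤ).map (Int.castRingHom ℚ)).quadraticTwist
        ((-67 : ℤ) : ℚ)).mordellWeilRank *
          Nat.card ↥(AddSubgroup.torsionBy (((⟨0, -1, 1, -24, 54⟩ : WeierstrassCurve ℤ).map (Int.castRingHom ℚ)).quadraticTwist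
        ((-67 : ℤ) : ℚ)).toAffine.Point ((5 : ℕ) : ℤ)) *
          Nat.card ↥((((⟨0, -1, 1, -24, 54⟩ : WeierstrassCurve ℤ).map (Int.castRingHom ℚ)).quadraticTwist
        ((-67 : ℤ) : ℚ)).sha ⊓
            AddSubgroup.torsionBy (((⟨0, -1, 1, -24, 54⟩ : WeierstrassCurve ℤ).map (Int.castRingHom ℚ)).quadraticTwist
        ((-67 : ℤ) : ℚ)).galH1 ((5 : ℕ) : ℤ)) ≤ 5 := by
  haveI := isElliptic_c997c1
  haveI := isGloballyMinimal_c997c1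
  haveI : NeZero (((⟨0, -1, 1, -24, 54⟩ : WeierstrassCurve ℤ).map (Int.castRingHom ℚ)).conductorNorm ℤ) :=
    neZero_conductorNorm_of_isElliptic _
  intro Dt β ι d hne
  haveI := Fact.mk (by norm_num : Nat.Prime 5)
  exact depthRow_twistSelmer_printKN_of_datum_of_intModel_certificate intModel h372 not_hasCM
    KernelCerts003.C997c1.two_le_rank 5 (by norm_num) hasSurjectiveModNGaloisRep_pow_5 K hK hD
    (by norm_num) (by norm_num) heegner_neg67 229 (by norm_num) (by norm_num) (by decide +kernel)
    (by norm_num) (by norm_num) (by norm_num) (by norm_num) (n := 255) card_229 (by norm_num)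
    (Δ₀ := 997) (by decide +kernel) (B := 11) (by decide +kernel) (by decide +kernel)
    (fun _ _ ↦ Or.inl (by norm_num)) Dt β ι d hne

end C997c1

namespace C664a1

/-- **DEPTH-TABLE ROW `664a1`, `(p, d_K, ℓ) = (5, -39, 29)` — THE TWIST'S `5`-SELMER GROUP, without
Kolyvagin's structure theorem, without a point on the twist, and WITHOUT A SYSTEM.** Hypotheses
those of `C664a1.depthRow_5_neg39_29_print` ((γ) = Gross 1991 Prop. 3.7 (2) in place of the five
McCallum/Gross leaves — three are theorems after g8, Lemma 4.3 is proved on the Kodaira–Néron cell,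
certified here from `Δ(E₀) = -21248` —, any imaginary quadratic `K` with `d_K = -39`, any frame, ANY
single datum `d` of conductor `29` — NO system — and its bit `d.kolyvaginClass _ 1 ≠ 0`);
conclusion: `#Sel^(5)(E^{(-39)}/ℚ) ≤ 5` (i.e. `dim_𝔽5 Sel_5(E^{(-39)}/ℚ) ≤ 1`) and the descent count
`5^{rank E^{(-39)}(ℚ)} · #E^{(-39)}(ℚ)[5] · #Ш(E^{(-39)}/ℚ)[5] ≤ 5` — Kolyvagin's second eigen-bound
`#Sel(E/K)_5^- ≤ 5` read over `ℚ` (kit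
`depthRow_twistSelmer_printKN_of_datum_of_intModel_certificate`; the compatible system through `d`
is the theorem `exists_kolyvaginHeegnerSystem_extending`); the hF-free, twist-point-free counterpart
of the hF-row's `corank Sel_{5^∞}(E^{(-39)}/ℚ) = 1`. CONDITIONAL on (γ) and the bit; per-curve; BSD
is not proved by it. [cite: Kolyvagin1991MathAnn, Thm. 2.3] [cite: McCallumLMS1991, §§2–5] [cite:
GrossLMS1991, §5 (5.1)] [cite: JetchevLauterStein2009, §3.6 (arXiv:0707.0032)] -/
theorem twistSelmer_5_neg39_29_printKN
    (h372 : GrossLMS1991.prop37_2_frobeniusCongruence)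
    (K : Type) [Field K] [NumberField K] (hK : IsImaginaryQuadratic K)
    (hD : NumberField.discr K = -39) :
    haveI := isElliptic_c664a1;
    haveI := isGloballyMinimal_c664a1;
    haveI : NeZero (((⟨0, 0, 0, -7, 10⟩ : WeierstrassCurve ℤ).map (Int.castRingHom ℚ)).conductorNorm ℤ) :=
      neZero_conductorNorm_of_isElliptic _;
    ∀ (Dt : ModularParametrizationData ((⟨0, 0, 0, -7, 10⟩ : WeierstrassCurve ℤ).map (Int.castRingHom ℚ))
        (((⟨0, 0, 0, -7, 10⟩ : WeierstrassCurve ℤ).map (Int.castRingHom ℚ)).conductorNorm ℤ)) (β : ℤ)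
      (ι : K →+* ℂ) (d : KolyvaginHeegnerData Dt β ι 29),
    d.kolyvaginClass (p := 5) (by norm_num) 1 ≠ 0 →
    Nat.card ↥(selmerGroup (((⟨0, 0, 0, -7, 10⟩ : WeierstrassCurve ℤ).map (Int.castRingHom ℚ)).quadraticTwist
        ((-39 : ℤ) : ℚ)) ((5 : ℕ) : ℤ)) ≤ 5 ∧
      5 ^ (((⟨0, 0, 0, -7, 10⟩ : WeierstrassCurve ℤ).map (Int.castRingHom ℚ)).quadraticTwist
        ((-39 : ℤ) : ℚ)).mordellWeilRank *
          Nat.card ↥(AddSubgroup.torsionBy (((⟨0, 0, 0, -7, 10⟩ : WeierstrassCurve ℤ).map (Int.castRingHom ℚ)).quadraticTwist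
        ((-39 : ℤ) : ℚ)).toAffine.Point ((5 : ℕ) : ℤ)) *
          Nat.card ↥((((⟨0, 0, 0, -7, 10⟩ : WeierstrassCurve ℤ).map (Int.castRingHom ℚ)).quadraticTwist
        ((-39 : ℤ) : ℚ)).sha ⊓
            AddSubgroup.torsionBy (((⟨0, 0, 0, -7, 10⟩ : WeierstrassCurve ℤ).map (Int.castRingHom ℚ)).quadraticTwist
        ((-39 : ℤ) : ℚ)).galH1 ((5 : ℕ) : ℤ)) ≤ 5 := by
  haveI := isElliptic_c664a1
  haveI := isGloballyMinimal_c664a1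
  haveI : NeZero (((⟨0, 0, 0, -7, 10⟩ : WeierstrassCurve ℤ).map (Int.castRingHom ℚ)).conductorNorm ℤ) :=
    neZero_conductorNorm_of_isElliptic _
  intro Dt β ι d hne
  haveI := Fact.mk (by norm_num : Nat.Prime 5)
  exact depthRow_twistSelmer_printKN_of_datum_of_intModel_certificate intModel h372 not_hasCM
    KernelCerts001.C664a1.two_le_rank 5 (by norm_num) hasSurjectiveModNGaloisRep_pow_5 K hK hD
    (by norm_num) (by norm_num) heegner_neg39 29 (by norm_num) (by norm_num) (by decide +kernel)
    (by norm_num) (by norm_num) (by norm_num) (by norm_num) (n := 25) card_29 (by norm_num)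
    (Δ₀ := -21248) (by decide +kernel) (B := 11) (by decide +kernel) (by decide +kernel)
    (fun _ _ ↦ Or.inl (by norm_num)) Dt β ι d hne

end C664a1

namespace C916c1

/-- **DEPTH-TABLE ROW `916c1`, `(p, d_K, ℓ) = (5, -111, 19)` — THE TWIST'S `5`-SELMER GROUP, without
Kolyvagin's structure theorem, without a point on the twist, and WITHOUT A SYSTEM.** Hypotheses
those of `C916c1.depthRow_5_neg111_19_print` ((γ) = Gross 1991 Prop. 3.7 (2) in place of the five
McCallum/Gross leaves — three are theorems after g8, Lemma 4.3 is proved on the Kodaira–Néron cell,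
certified here from `Δ(E₀) = 3664` —, any imaginary quadratic `K` with `d_K = -111`, any frame, ANY
single datum `d` of conductor `19` — NO system — and its bit `d.kolyvaginClass _ 1 ≠ 0`);
conclusion: `#Sel^(5)(E^{(-111)}/ℚ) ≤ 5` (i.e. `dim_𝔽5 Sel_5(E^{(-111)}/ℚ) ≤ 1`) and the descent
count `5^{rank E^{(-111)}(ℚ)} · #E^{(-111)}(ℚ)[5] · #Ш(E^{(-111)}/ℚ)[5] ≤ 5` — Kolyvagin's second
eigen-bound `#Sel(E/K)_5^- ≤ 5` read over `ℚ` (kit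
`depthRow_twistSelmer_printKN_of_datum_of_intModel_certificate`; the compatible system through `d`
is the theorem `exists_kolyvaginHeegnerSystem_extending`); the hF-free, twist-point-free counterpart
of the hF-row's `corank Sel_{5^∞}(E^{(-111)}/ℚ) = 1`. CONDITIONAL on (γ) and the bit; per-curve; BSD
is not proved by it. [cite: Kolyvagin1991MathAnn, Thm. 2.3] [cite: McCallumLMS1991, §§2–5] [cite:
GrossLMS1991, §5 (5.1)] [cite: JetchevLauterStein2009, §3.6 (arXiv:0707.0032)] -/
theorem twistSelmer_5_neg111_19_printKN
    (h372 : GrossLMS1991.prop37_2_frobeniusCongruence)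
    (K : Type) [Field K] [NumberField K] (hK : IsImaginaryQuadratic K)
    (hD : NumberField.discr K = -111) :
    haveI := isElliptic_c916c1;
    haveI := isGloballyMinimal_c916c1;
    haveI : NeZero (((⟨0, 0, 0, -4, 1⟩ : WeierstrassCurve ℤ).map (Int.castRingHom ℚ)).conductorNorm ℤ) :=
      neZero_conductorNorm_of_isElliptic _;
    ∀ (Dt : ModularParametrizationData ((⟨0, 0, 0, -4, 1⟩ : WeierstrassCurve ℤ).map (Int.castRingHom ℚ))
        (((⟨0, 0, 0, -4, 1⟩ : WeierstrassCurve ℤ).map (Int.castRingHom ℚ)).conductorNorm ℤ)) (β : ℤ)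
      (ι : K →+* ℂ) (d : KolyvaginHeegnerData Dt β ι 19),
    d.kolyvaginClass (p := 5) (by norm_num) 1 ≠ 0 →
    Nat.card ↥(selmerGroup (((⟨0, 0, 0, -4, 1⟩ : WeierstrassCurve ℤ).map (Int.castRingHom ℚ)).quadraticTwist
        ((-111 : ℤ) : ℚ)) ((5 : ℕ) : ℤ)) ≤ 5 ∧
      5 ^ (((⟨0, 0, 0, -4, 1⟩ : WeierstrassCurve ℤ).map (Int.castRingHom ℚ)).quadraticTwist
        ((-111 : ℤ) : ℚ)).mordellWeilRank *
          Nat.card ↥(AddSubgroup.torsionBy (((⟨0, 0, 0, -4, 1⟩ : WeierstrassCurve ℤ).map (Int.castRingHom ℚ)).quadraticTwist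
        ((-111 : ℤ) : ℚ)).toAffine.Point ((5 : ℕ) : ℤ)) *
          Nat.card ↥((((⟨0, 0, 0, -4, 1⟩ : WeierstrassCurve ℤ).map (Int.castRingHom ℚ)).quadraticTwist
        ((-111 : ℤ) : ℚ)).sha ⊓
            AddSubgroup.torsionBy (((⟨0, 0, 0, -4, 1⟩ : WeierstrassCurve ℤ).map (Int.castRingHom ℚ)).quadraticTwist
        ((-111 : ℤ) : ℚ)).galH1 ((5 : ℕ) : ℤ)) ≤ 5 := by
  haveI := isElliptic_c916c1
  haveI := isGloballyMinimal_c916c1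
  haveI : NeZero (((⟨0, 0, 0, -4, 1⟩ : WeierstrassCurve ℤ).map (Int.castRingHom ℚ)).conductorNorm ℤ) :=
    neZero_conductorNorm_of_isElliptic _
  intro Dt β ι d hne
  haveI := Fact.mk (by norm_num : Nat.Prime 5)
  exact depthRow_twistSelmer_printKN_of_datum_of_intModel_certificate intModel h372 not_hasCM
    KernelCerts002.C916c1.two_le_rank 5 (by norm_num) hasSurjectiveModNGaloisRep_pow_5 K hK hD
    (by norm_num) (by norm_num) heegner_neg111 19 (by norm_num) (by norm_num) (by decide +kernel)
    (by norm_num) (by norm_num) (by norm_num) (by norm_num) (n := 25) card_19 (by norm_num)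
    (Δ₀ := 3664) (by decide +kernel) (B := 11) (by decide +kernel) (by decide +kernel)
    (fun _ _ ↦ Or.inl (by norm_num)) Dt β ι d hne

end C916c1


end Summit.BirchSwinnertonDyer.BirchSwinnertonDyer.Theorems.KolyvaginDepthDoor

end
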